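import Mathlib
import Summits.Ventures.HodgeRepro2.T5DegreeOneIntegers

/-!
# T5DegreeOneNumberField — `F_𝔭 ≃ ℚ_p` at a degree-one prime of a number field

Tier-5 kernel support (seat p7), file (6) of the chain behind route/T5-LEAN-p7.md §22 (fourth
addendum) and §33: the instantiation of `T5DegreeOneCompletion` at a NUMBER FIELD `F` with ring of
integers `𝓞 F`, a finite place `w : HeightOneSpectrum (𝓞 F)` lying over the rational prime `p`
(Mathlib's `w.asIdeal.LiesOver (span {p})`) of degree one in Mathlib's vocabulary,
`w.asIdeal.ramificationIdx ℤ * w.asIdeal.inertiaDeg ℤ = 1` (the form used by the cell's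
`T5SplitsCompletely` / `T5DecompositionTrivial` / `T5OrdinaryCMType`):
* `ramificationIdx_eq_one`, `inertiaDeg_eq_one`, `natCast_mem`, `natCast_notMem_sq`,
  `exists_int_sub_mem` — the elementary hypotheses of the chain read off `e · f = 1`;
* `completionEquivPadic : w.adicCompletion F ≃+* ℚ_[p]` and
  `completionUniformEquivPadic : w.adicCompletion F ≃ᵤ ℚ_[p]` — THE COMPLETION READING
  «`F_𝔭 = ℚ_p` at a degree-one `𝔭`» (CHECK-G S0 / §12.2 rows P1.2, P1.9; T5-LEAN-p7 §22 (b)(iv)),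
  restricting to `toPadic` on `F` and to `toPadicInt` on `𝓞 F`;
* `integersToPadicInt : 𝓞 F →+* ℤ_[p]` with dense range and `x ∈ 𝔭 ^ n ↔ ‖x‖ ≤ p⁻ⁿ`;
* `integersEquivPadicInt : w.adicCompletionIntegers F ≃+* ℤ_[p]` — «`𝒪_{F,𝔭} = ℤ_p`» (§33 / §34).

Mathlib only beyond the chain; nothing about the cell's specific datum (the sextic CM field, the
chosen prime) is declared — the datum supplies `F`, `w`, `p` and `e · f = 1` (CHECK-G S0).
-/

namespace Summit.Ventures.HodgeRepro2.T5DegreeOneNumberField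

open Ideal IsDedekindDomain NumberField
open Summit.Ventures.HodgeRepro2.T5DegreeOneQuotient Summit.Ventures.HodgeRepro2.T5DegreeOnePadicInt
  Summit.Ventures.HodgeRepro2.T5DegreeOnePadic Summit.Ventures.HodgeRepro2.T5DegreeOneCompletion
  Summit.Ventures.HodgeRepro2.T5DegreeOneIntegers

variable {F : Type*} [Field F] [NumberField F] (w : HeightOneSpectrum (𝓞 F)) (p : ℕ)
  [hp : Fact p.Prime] [hw : w.asIdeal.LiesOver (Ideal.span {(p : ℤ)})]
  (hdeg : w.asIdeal.ramificationIdx ℤ * w.asIdeal.inertiaDeg ℤ = 1)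

omit [NumberField F] hp hdeg in
/-- `p ∈ 𝔭`. -/
theorem natCast_mem : (p : 𝓞 F) ∈ w.asIdeal := natCast_mem_of_liesOver

include hdeg

omit [NumberField F] in
/-- `e = 1` from `e · f = 1`. -/
theorem ramificationIdx_eq_one : w.asIdeal.ramificationIdx ℤ = 1 :=
  Nat.eq_one_of_mul_eq_one_right hdeg

omit [NumberField F] in
/-- `f = 1` from `e · f = 1`. -/
theorem inertiaDeg_eq_one : w.asIdeal.inertiaDeg ℤ = 1 :=
  Nat.eq_one_of_mul_eq_one_left hdeg

include p

/-- `p ∉ 𝔭 ^ 2` (`e = 1`). -/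
theorem natCast_notMem_sq : (p : 𝓞 F) ∉ w.asIdeal ^ 2 :=
  not_mem_sq_of_ramificationIdx_eq_one w.ne_bot (ramificationIdx_eq_one w hdeg)

/-- Every class of the residue field `𝓞 F ⧸ 𝔭` contains a rational integer (`f = 1`). -/
theorem exists_int_sub_mem (x : 𝓞 F) : ∃ a : ℤ, x - a ∈ w.asIdeal :=
  haveI : w.asIdeal.IsMaximal := w.isPrime.isMaximal w.ne_bot
  exists_int_sub_mem_of_inertiaDeg_eq_one (p := p) (inertiaDeg_eq_one w hdeg) x

/-- THE COMPLETION READING: at a degree-one prime `𝔭 ∣ p` of the number field `F`, Mathlib's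
`w.adicCompletion F` (the completion `F_𝔭`) is isomorphic to `ℚ_[p]` as a ring. -/
noncomputable def completionEquivPadic : w.adicCompletion F ≃+* ℚ_[p] :=
  adicCompletionRingEquiv w (natCast_mem w p) (natCast_notMem_sq w p hdeg) (exists_int_sub_mem w p hdeg)

/-- `F_𝔭 ≃ᵤ ℚ_[p]` as uniform spaces (the same map). -/
noncomputable def completionUniformEquivPadic : w.adicCompletion F ≃ᵤ ℚ_[p] :=
  adicCompletionUniformEquiv w (natCast_mem w p) (natCast_notMem_sq w p hdeg) (exists_int_sub_mem w p hdeg)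

/-- The two isomorphisms are the same map. -/
theorem coe_completionUniformEquivPadic :
    ⇑(completionUniformEquivPadic w p hdeg) = ⇑(completionEquivPadic w p hdeg) := rfl

/-- `completionEquivPadic` is continuous (a homeomorphism). -/
theorem continuous_completionEquivPadic : Continuous (completionEquivPadic w p hdeg) :=
  continuous_adicCompletionRingEquiv w (natCast_mem w p) (natCast_notMem_sq w p hdeg)
    (exists_int_sub_mem w p hdeg)

/-- `completionEquivPadic` restricts on `F ⊆ F_𝔭` to the embedding `toPadic : F →+* ℚ_[p]`. -/
theorem completionEquivPadic_coe (k : F) :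
    completionEquivPadic w p hdeg (k : w.adicCompletion F) =
      toPadic w (natCast_mem w p) (natCast_notMem_sq w p hdeg) (exists_int_sub_mem w p hdeg) k :=
  adicCompletionRingEquiv_coe w (natCast_mem w p) (natCast_notMem_sq w p hdeg) (exists_int_sub_mem w p hdeg) k

/-- `completionEquivPadic` restricts on `𝓞 F` to `toPadicInt : 𝓞 F →+* ℤ_[p]` (a `p`-adic integer). -/
theorem completionEquivPadic_algebraMap (r : 𝓞 F) :
    completionEquivPadic w p hdeg (algebraMap (𝓞 F) (w.adicCompletion F) r) =
      (toPadicInt w.ne_bot (natCast_mem w p) (natCast_notMem_sq w p hdeg) (exists_int_sub_mem w p hdeg) r :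
        ℚ_[p]) :=
  adicCompletionRingEquiv_algebraMap w (natCast_mem w p) (natCast_notMem_sq w p hdeg)
    (exists_int_sub_mem w p hdeg) r

/-- The embedding `𝓞 F →+* ℤ_[p]` at a degree-one prime. -/
noncomputable def integersToPadicInt : 𝓞 F →+* ℤ_[p] :=
  toPadicInt w.ne_bot (natCast_mem w p) (natCast_notMem_sq w p hdeg) (exists_int_sub_mem w p hdeg)

/-- `integersToPadicInt` is injective. -/
theorem integersToPadicInt_injective : Function.Injective (integersToPadicInt w p hdeg) :=
  toPadicInt_injective w.ne_bot (natCast_mem w p) (natCast_notMem_sq w p hdeg) (exists_int_sub_mem w p hdeg)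

/-- `integersToPadicInt` has dense range (`𝓞 F ⊇ ℤ` is dense in `ℤ_[p]`). -/
theorem denseRange_integersToPadicInt : DenseRange (integersToPadicInt w p hdeg) :=
  denseRange_toPadicInt w.ne_bot (natCast_mem w p) (natCast_notMem_sq w p hdeg) (exists_int_sub_mem w p hdeg)

/-- `x ∈ 𝔭 ^ n ↔ ‖integersToPadicInt x‖ ≤ p⁻ⁿ`: the `𝔭`-adic filtration of `𝓞 F` is the `p`-adic
one. -/
theorem mem_pow_iff_norm_le (n : ℕ) (x : 𝓞 F) :
    x ∈ w.asIdeal ^ n ↔ ‖integersToPadicInt w p hdeg x‖ ≤ (p : ℝ) ^ (-(n : ℤ)) :=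
  mem_pow_iff_norm_toPadicInt_le w.ne_bot (natCast_mem w p) (natCast_notMem_sq w p hdeg)
    (exists_int_sub_mem w p hdeg) n x

/-- `𝓞 F ⧸ 𝔭 ^ n ≃+* ZMod (p ^ n)` at a degree-one prime. -/
noncomputable def quotPowEquivZMod' (n : ℕ) : 𝓞 F ⧸ w.asIdeal ^ n ≃+* ZMod (p ^ n) :=
  quotPowEquivZMod w.ne_bot (natCast_mem w p) (natCast_notMem_sq w p hdeg) (exists_int_sub_mem w p hdeg) n

/-- `|𝓞 F ⧸ 𝔭 ^ n| = p ^ n` at a degree-one prime. -/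
theorem natCard_quot_pow' (n : ℕ) : Nat.card (𝓞 F ⧸ w.asIdeal ^ n) = p ^ n :=
  natCard_quot_pow w.ne_bot (natCast_mem w p) (natCast_notMem_sq w p hdeg) (exists_int_sub_mem w p hdeg) n

/-- The `w`-adic valuation of `F` is the pull-back of the `p`-adic valuation of `ℚ_[p]`. -/
theorem comap_mulValuation :
    (Padic.mulValuation (p := p)).comap
      (toPadic w (natCast_mem w p) (natCast_notMem_sq w p hdeg) (exists_int_sub_mem w p hdeg) (K := F)) =
      w.valuation F :=
  comap_mulValuation_toPadic w (natCast_mem w p) (natCast_notMem_sq w p hdeg) (exists_int_sub_mem w p hdeg)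

/-- THE INTEGERS: at a degree-one prime `𝔭 ∣ p`, the valuation ring `𝒪_{F,𝔭}` of the completion
(Mathlib's `w.adicCompletionIntegers F`) is isomorphic to `ℤ_[p]` (T5-LEAN-p7 §33 / §34). -/
noncomputable def integersEquivPadicInt : w.adicCompletionIntegers F ≃+* ℤ_[p] :=
  integersRingEquiv w (natCast_mem w p) (natCast_notMem_sq w p hdeg) (exists_int_sub_mem w p hdeg)

/-- `integersEquivPadicInt` is the restriction of `completionEquivPadic`. -/
theorem coe_integersEquivPadicInt (x : w.adicCompletionIntegers F) :
    (integersEquivPadicInt w p hdeg x : ℚ_[p]) = completionEquivPadic w p hdeg (x : w.adicCompletion F) :=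
  rfl

/-- `integersEquivPadicInt` restricts to `integersToPadicInt` on `𝓞 F`. -/
theorem integersEquivPadicInt_algebraMap (r : 𝓞 F) :
    integersEquivPadicInt w p hdeg (algebraMap (𝓞 F) (w.adicCompletionIntegers F) r) =
      integersToPadicInt w p hdeg r :=
  integersRingEquiv_algebraMap w (natCast_mem w p) (natCast_notMem_sq w p hdeg)
    (exists_int_sub_mem w p hdeg) r

/-- `x ∈ 𝒪_{F,𝔭}` iff its image is a `p`-adic integer. -/
theorem mem_adicCompletionIntegers_iff' (x : w.adicCompletion F) :
    x ∈ w.adicCompletionIntegers F ↔ completionEquivPadic w p hdeg x ∈ PadicInt.subring p :=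
  mem_adicCompletionIntegers_iff w (natCast_mem w p) (natCast_notMem_sq w p hdeg)
    (exists_int_sub_mem w p hdeg) x

end Summit.Ventures.HodgeRepro2.T5DegreeOneNumberField
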